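import Summits.QuantumFields.YangMills.Theorems.CurvatureKernelBound.Negative.KWGeneric1
import Summits.QuantumFields.YangMills.Theorems.CurvatureKernelBound.Negative.FlatN

/-!
# `CurvatureKernelBound` — negative lemmas: Wick integrands of an admissible kernel on `⁰𝒮ₙ` (family-level witnesses, I)

Supports crux item `stmt-QuantumFields-11687` (`PencilRigidity.CurvatureKernelBound`). Standing disprover's infrastructure
(refuter, cdisprove cycle 3) towards the FAMILY-level `_false_without_lattice` theorem (the centred Gaussian family of an
admissible axis-RP kernel satisfies the whole curvature package `W₁` minus the lattice tie, yet has a two-point kernel of order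
ten). This file: for an admissible kernel `K` (`KernelWitness.AdmissibleKernel`), arity `n` and `σ ∈ Sₙ`, the Wick weight
`wickW K σ x = ∏_{i<n/2} K(x_{σ(2i)} − x_{σ(2i+1)})`; the minimal pair distance of a configuration; the DOMINATION
`‖wickW σ x · F x‖ ≤ Aⁿ′ 3ᵏ (1+‖x‖)⁻ᵏ SNn k (5n) F` on `⁰𝒮ₙ` (`k = 4n+1`; flatness `FlatN.norm_le_flat` at the closest pair
pays every `‖·‖⁻¹⁰`), integrability, and the seminorm bound of `F ↦ ∫ wickW σ · F`. No conclusion below asserts a Theses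
statement positively. [folklore]
-/

open scoped BigOperators Topology SchwartzMap
open MeasureTheory Filter Set Real
open Literature.MathematicalPhysics.QuantumLattice Literature.MathematicalPhysics.AQFT

noncomputable section

namespace Summit.QuantumFields.YangMills.Theorems.CurvatureKernelBound.Negative

namespace Wick

open KernelWitness (AdmissibleKernel)
open FlatN (SNn SNn_nonneg norm_le_flat norm_le_SNn SNn_mono_right)

variable {K : E4 → ℝ} {n : ℕ}

/-! ### Pair indices and the Wick weight of a permutation -/

/-- The `i`-th pair of positions `(2i, 2i+1)` in `Fin n`, `i < n/2`. [folklore] -/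
def pairFst (i : Fin (n / 2)) : Fin n := ⟨2 * i, by omega⟩

/-- The second position of the `i`-th pair. [folklore] -/
def pairSnd (i : Fin (n / 2)) : Fin n := ⟨2 * i + 1, by omega⟩

/-- Auxiliary fact `pairFst_ne_pairSnd` (see the module docstring). [folklore] -/
theorem pairFst_ne_pairSnd (i : Fin (n / 2)) : pairFst i ≠ pairSnd i := by
  intro h; have := congrArg Fin.val h; simp [pairFst, pairSnd] at this

/-- **The Wick weight** of `σ`: `∏_{i<n/2} K(x_{σ(2i)} − x_{σ(2i+1)})`. [folklore] -/
def wickW (K : E4 → ℝ) (σ : Equiv.Perm (Fin n)) (x : Fin n → E4) : ℝ :=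
  ∏ i : Fin (n / 2), K (x (σ (pairFst i)) - x (σ (pairSnd i)))

/-- Auxiliary fact `wickW_nonneg` (see the module docstring). [folklore] -/
theorem wickW_nonneg (hK : AdmissibleKernel K) (σ : Equiv.Perm (Fin n)) (x : Fin n → E4) : 0 ≤ wickW K σ x :=
  Finset.prod_nonneg fun _ _ => hK.nonneg _

/-- Auxiliary fact `measurable_wickW` (see the module docstring). [folklore] -/
theorem measurable_wickW (hK : AdmissibleKernel K) (σ : Equiv.Perm (Fin n)) : Measurable (wickW K σ) := by
  unfold wickW
  refine Finset.measurable_prod _ fun i _ => ?_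
  exact hK.measurable.comp ((measurable_pi_apply _).sub (measurable_pi_apply _))

/-! ### The minimal pair distance -/

/-- The set of ordered pairs of distinct positions. [folklore] -/
def pairs (n : ℕ) : Finset (Fin n × Fin n) := Finset.univ.filter fun p => p.1 ≠ p.2

/-- Auxiliary fact `mem_pairs` (see the module docstring). [folklore] -/
theorem mem_pairs {p : Fin n × Fin n} : p ∈ pairs n ↔ p.1 ≠ p.2 := by simp [pairs]

/-- Auxiliary fact `pairs_nonempty` (see the module docstring). [folklore] -/
theorem pairs_nonempty (h : 2 ≤ n) : (pairs n).Nonempty :=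
  ⟨(⟨0, by omega⟩, ⟨1, by omega⟩), mem_pairs.2 (by intro h'; have := congrArg Fin.val h'; simp at this)⟩

/-- The minimal distance between two distinct points of a configuration (`n ≥ 2`). [folklore] -/
def minDist (h : 2 ≤ n) (x : Fin n → E4) : ℝ :=
  (pairs n).inf' (pairs_nonempty h) fun p => ‖x p.1 - x p.2‖

/-- Auxiliary fact `minDist_le` (see the module docstring). [folklore] -/
theorem minDist_le (h : 2 ≤ n) (x : Fin n → E4) {a b : Fin n} (hab : a ≠ b) : minDist h x ≤ ‖x a - x b‖ :=
  Finset.inf'_le _ (mem_pairs.2 (show (a, b).1 ≠ (a, b).2 from hab))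

/-- Auxiliary fact `exists_minDist_eq` (see the module docstring). [folklore] -/
theorem exists_minDist_eq (h : 2 ≤ n) (x : Fin n → E4) :
    ∃ a b : Fin n, a ≠ b ∧ ‖x a - x b‖ = minDist h x := by
  obtain ⟨p, hp, hpe⟩ := Finset.exists_mem_eq_inf' (pairs_nonempty h) fun p : Fin n × Fin n => ‖x p.1 - x p.2‖
  exact ⟨p.1, p.2, mem_pairs.1 hp, by rw [minDist, hpe]⟩

/-- Auxiliary fact `minDist_nonneg` (see the module docstring). [folklore] -/
theorem minDist_nonneg (h : 2 ≤ n) (x : Fin n → E4) : 0 ≤ minDist h x := by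
  obtain ⟨a, b, -, he⟩ := exists_minDist_eq h x
  rw [← he]; exact norm_nonneg _

/-! ### Domination of the Wick integrand on `⁰𝒮ₙ` -/

/-- One factor: `K(x_a − x_b) ≤ A · max 1 (m⁻¹⁰)` whenever `m ≤ ‖x_a − x_b‖`, `m > 0`. [folklore] -/
theorem factor_le (hK : AdmissibleKernel K) {x : Fin n → E4} {a b : Fin n} {m : ℝ} (hm : 0 < m)
    (hmab : m ≤ ‖x a - x b‖) : K (x a - x b) ≤ hK.A * max 1 (m⁻¹ ^ 10) := by
  have hw : x a - x b ≠ 0 := by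
    intro h0; rw [h0, norm_zero] at hmab; linarith
  have hKle := hK.le _ hw
  have hinv : ‖x a - x b‖⁻¹ ^ 10 ≤ max 1 (m⁻¹ ^ 10) :=
    (pow_le_pow_left₀ (by positivity) (inv_anti₀ hm hmab) 10).trans (le_max_right _ _)
  exact hKle.trans (mul_le_mul_of_nonneg_left hinv hK.A_nonneg)

/-- The Wick weight is bounded by `(A · max 1 (m⁻¹⁰))^{n/2}` with `m` the minimal pair distance. [folklore] -/
theorem wickW_le (hK : AdmissibleKernel K) (h : 2 ≤ n) (σ : Equiv.Perm (Fin n)) (x : Fin n → E4)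
    (hm : 0 < minDist h x) :
    wickW K σ x ≤ (hK.A * max 1 ((minDist h x)⁻¹ ^ 10)) ^ (n / 2) := by
  unfold wickW
  calc ∏ i : Fin (n / 2), K (x (σ (pairFst i)) - x (σ (pairSnd i)))
      ≤ ∏ _i : Fin (n / 2), hK.A * max 1 ((minDist h x)⁻¹ ^ 10) := by
        refine Finset.prod_le_prod (fun i _ => hK.nonneg _) fun i _ => ?_
        exact factor_le hK hm (minDist_le h x (fun h' => pairFst_ne_pairSnd i (σ.injective h')))
    _ = (hK.A * max 1 ((minDist h x)⁻¹ ^ 10)) ^ (n / 2) := by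
        rw [Finset.prod_const, Finset.card_univ, Fintype.card_fin]

/-- The integrable dominator `(1 + ‖x‖)⁻⁽⁴ⁿ⁺¹⁾` on `(ℝ⁴)ⁿ`. [folklore] -/
def wtn (n : ℕ) (x : Fin n → E4) : ℝ := (1 + ‖x‖)⁻¹ ^ (4 * n + 1)

/-- Auxiliary fact `wtn_nonneg` (see the module docstring). [folklore] -/
theorem wtn_nonneg (x : Fin n → E4) : 0 ≤ wtn n x := by unfold wtn; positivity

/-- Auxiliary fact `finrank_confign` (see the module docstring). [folklore] -/
theorem finrank_confign : Module.finrank ℝ (Fin n → E4) = 4 * n := by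
  simp [Module.finrank_pi_fintype]; ring

/-- Auxiliary fact `integrable_wtn` (see the module docstring). [folklore] -/
theorem integrable_wtn : Integrable (wtn n) := by
  have h := integrable_one_add_norm (E := Fin n → E4) (μ := volume) (r := (4 * n + 1 : ℕ))
    (by rw [finrank_confign]; push_cast; linarith)
  refine h.congr (ae_of_all _ fun x => ?_)
  show (1 + ‖x‖) ^ (-((4 * n + 1 : ℕ) : ℝ)) = (1 + ‖x‖)⁻¹ ^ (4 * n + 1)
  rw [Real.rpow_neg (by positivity), Real.rpow_natCast, inv_pow]

/-- The domination constant `A^{n/2} · 3^{4n+1}`. [folklore] -/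
def Cn (hK : AdmissibleKernel K) (n : ℕ) : ℝ := hK.A ^ (n / 2) * 3 ^ (4 * n + 1)

/-- Auxiliary fact `Cn_nonneg` (see the module docstring). [folklore] -/
theorem Cn_nonneg (hK : AdmissibleKernel K) (n : ℕ) : 0 ≤ Cn hK n := by
  unfold Cn; exact mul_nonneg (pow_nonneg hK.A_nonneg _) (by positivity)

/-- **Domination** of the Wick integrand on `⁰𝒮ₙ` (`n ≥ 2`):
`‖wickW σ x · F x‖ ≤ Cn · (1+‖x‖)⁻⁽⁴ⁿ⁺¹⁾ · SNn (4n+1) (5n) F`. [folklore] -/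
theorem norm_wickW_mul_le (hK : AdmissibleKernel K) (h : 2 ≤ n) (σ : Equiv.Perm (Fin n))
    {F : 𝓢((Fin n → E4), ℂ)} (hF : IsOffDiagonal F) (x : Fin n → E4) :
    ‖(wickW K σ x : ℂ) * F x‖ ≤ Cn hK n * wtn n x * SNn (4 * n + 1) (5 * n) F := by
  have hA := hK.A_nonneg
  have hrhs : 0 ≤ Cn hK n * wtn n x * SNn (4 * n + 1) (5 * n) F :=
    mul_nonneg (mul_nonneg (Cn_nonneg hK n) (wtn_nonneg x)) (SNn_nonneg _ _ _)
  obtain ⟨a, b, hab, hmin⟩ := exists_minDist_eq h x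
  rw [norm_mul, Complex.norm_real, Real.norm_of_nonneg (wickW_nonneg hK σ x)]
  by_cases hm0 : minDist h x = 0
  · -- coincident points: F vanishes
    have hxab : x a = x b := by
      rw [hm0] at hmin; exact sub_eq_zero.1 (norm_eq_zero.1 hmin)
    have hx : x ∈ coincidenceLocus n E4 := ⟨a, b, hab, hxab⟩
    rw [hF.apply_eq_zero hx, norm_zero, mul_zero]
    exact hrhs
  have hmpos : 0 < minDist h x := lt_of_le_of_ne (minDist_nonneg h x) (Ne.symm hm0)
  have hW := wickW_le hK h σ x hmpos
  have hn2 : 10 * (n / 2) ≤ 5 * n := by omega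
  by_cases h1 : minDist h x ≤ 1
  · -- near a partial diagonal: ten orders of flatness per pair
    have hmax : max 1 ((minDist h x)⁻¹ ^ 10) = (minDist h x)⁻¹ ^ 10 :=
      max_eq_right (one_le_pow₀ (one_le_inv_iff₀.2 ⟨hmpos, h1⟩))
    rw [hmax] at hW
    have hab1 : ‖x a - x b‖ ≤ 1 := by rw [hmin]; exact h1
    have hFx := norm_le_flat hF (4 * n + 1) (10 * (n / 2)) x hab hab1
    rw [hmin] at hFx
    have hFx' : ‖F x‖ ≤ 3 ^ (4 * n + 1) * (minDist h x / 2) ^ (10 * (n / 2)) * (1 + ‖x‖)⁻¹ ^ (4 * n + 1) *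
        SNn (4 * n + 1) (5 * n) F :=
      hFx.trans (mul_le_mul_of_nonneg_left (SNn_mono_right hn2 F) (by positivity))
    have hprod : (minDist h x)⁻¹ ^ (10 * (n / 2)) * (minDist h x / 2) ^ (10 * (n / 2)) = (1 / 2) ^ (10 * (n / 2)) := by
      rw [← mul_pow]; congr 1; field_simp
    calc wickW K σ x * ‖F x‖
        ≤ (hK.A * (minDist h x)⁻¹ ^ 10) ^ (n / 2) *
            (3 ^ (4 * n + 1) * (minDist h x / 2) ^ (10 * (n / 2)) * (1 + ‖x‖)⁻¹ ^ (4 * n + 1) *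
              SNn (4 * n + 1) (5 * n) F) :=
          mul_le_mul hW hFx' (norm_nonneg _) (by positivity)
      _ = hK.A ^ (n / 2) * 3 ^ (4 * n + 1) *
            ((minDist h x)⁻¹ ^ (10 * (n / 2)) * (minDist h x / 2) ^ (10 * (n / 2))) *
            (1 + ‖x‖)⁻¹ ^ (4 * n + 1) * SNn (4 * n + 1) (5 * n) F := by
          rw [mul_pow, ← pow_mul, show 10 * (n / 2) = 10 * (n / 2) from rfl]; ring
      _ = hK.A ^ (n / 2) * 3 ^ (4 * n + 1) * (1 / 2) ^ (10 * (n / 2)) *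
            (1 + ‖x‖)⁻¹ ^ (4 * n + 1) * SNn (4 * n + 1) (5 * n) F := by rw [hprod]
      _ ≤ hK.A ^ (n / 2) * 3 ^ (4 * n + 1) * 1 *
            (1 + ‖x‖)⁻¹ ^ (4 * n + 1) * SNn (4 * n + 1) (5 * n) F := by
          gcongr
          exact pow_le_one₀ (by norm_num) (by norm_num)
      _ = Cn hK n * wtn n x * SNn (4 * n + 1) (5 * n) F := by rw [Cn, wtn]; ring
  · -- all points at mutual distance ≥ 1
    have h1' : 1 < minDist h x := lt_of_not_ge h1
    have hmax : max 1 ((minDist h x)⁻¹ ^ 10) = 1 :=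
      max_eq_left (pow_le_one₀ (by positivity) (inv_le_one_of_one_le₀ h1'.le))
    rw [hmax, mul_one] at hW
    have hFx : ‖F x‖ ≤ 2 ^ (4 * n + 1) * (1 + ‖x‖)⁻¹ ^ (4 * n + 1) * SNn (4 * n + 1) (5 * n) F :=
      (norm_le_SNn F (4 * n + 1) x).trans
        (mul_le_mul_of_nonneg_left (SNn_mono_right (Nat.zero_le _) F) (by positivity))
    calc wickW K σ x * ‖F x‖
        ≤ hK.A ^ (n / 2) * (2 ^ (4 * n + 1) * (1 + ‖x‖)⁻¹ ^ (4 * n + 1) * SNn (4 * n + 1) (5 * n) F) :=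
          mul_le_mul hW hFx (norm_nonneg _) (by positivity)
      _ ≤ hK.A ^ (n / 2) * (3 ^ (4 * n + 1) * (1 + ‖x‖)⁻¹ ^ (4 * n + 1) * SNn (4 * n + 1) (5 * n) F) := by
          gcongr
          norm_num
      _ = Cn hK n * wtn n x * SNn (4 * n + 1) (5 * n) F := by rw [Cn, wtn]; ring

/-- Auxiliary fact `aestronglyMeasurable_wickW_mul` (see the module docstring). [folklore] -/
theorem aestronglyMeasurable_wickW_mul (hK : AdmissibleKernel K) (σ : Equiv.Perm (Fin n))
    (F : 𝓢((Fin n → E4), ℂ)) : AEStronglyMeasurable (fun x => (wickW K σ x : ℂ) * F x) volume :=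
  ((Complex.measurable_ofReal.comp (measurable_wickW hK σ)).aestronglyMeasurable).mul
    F.continuous.aestronglyMeasurable

/-- **Integrability** of the Wick integrand against `⁰𝒮ₙ` (`n ≥ 2`). [folklore] -/
theorem integrable_wickW_mul (hK : AdmissibleKernel K) (h : 2 ≤ n) (σ : Equiv.Perm (Fin n))
    {F : 𝓢((Fin n → E4), ℂ)} (hF : IsOffDiagonal F) :
    Integrable (fun x => (wickW K σ x : ℂ) * F x) :=
  Integrable.mono' ((integrable_wtn.const_mul (Cn hK n)).mul_const (SNn (4 * n + 1) (5 * n) F))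
    (aestronglyMeasurable_wickW_mul hK σ F) (ae_of_all _ (norm_wickW_mul_le hK h σ hF))

/-- The seminorm-bound constant. [folklore] -/
def Cbn (hK : AdmissibleKernel K) (n : ℕ) : ℝ := Cn hK n * ∫ x : Fin n → E4, wtn n x

/-- Auxiliary fact `Cbn_nonneg` (see the module docstring). [folklore] -/
theorem Cbn_nonneg (hK : AdmissibleKernel K) (n : ℕ) : 0 ≤ Cbn hK n :=
  mul_nonneg (Cn_nonneg hK n) (integral_nonneg wtn_nonneg)

/-- **Seminorm bound** `‖∫ wickW σ · F‖ ≤ Cbn · SNn (4n+1) (5n) F` on `⁰𝒮ₙ` (`n ≥ 2`). [folklore] -/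
theorem norm_integral_wickW_mul_le (hK : AdmissibleKernel K) (h : 2 ≤ n) (σ : Equiv.Perm (Fin n))
    {F : 𝓢((Fin n → E4), ℂ)} (hF : IsOffDiagonal F) :
    ‖∫ x, (wickW K σ x : ℂ) * F x‖ ≤ Cbn hK n * SNn (4 * n + 1) (5 * n) F := by
  calc ‖∫ x, (wickW K σ x : ℂ) * F x‖ ≤ ∫ x, Cn hK n * wtn n x * SNn (4 * n + 1) (5 * n) F :=
        norm_integral_le_of_norm_le ((integrable_wtn.const_mul (Cn hK n)).mul_const _)
          (ae_of_all _ (norm_wickW_mul_le hK h σ hF))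
    _ = Cbn hK n * SNn (4 * n + 1) (5 * n) F := by
        rw [integral_mul_const, integral_const_mul, Cbn]

end Wick

end Summit.QuantumFields.YangMills.Theorems.CurvatureKernelBound.Negative
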